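import Literature.NumberTheory.EllipticCurves.Rank1Residual.X9SmallImage
import Literature.NumberTheory.EllipticCurves.Rank1Residual.Dedup
import Literature.NumberTheory.EllipticCurves.Rank1Residual.X11
import Literature.NumberTheory.EllipticCurves.BSDSelmerPConverseRamifiedProofs
import Literature.NumberTheory.EllipticCurves.SemistableModPImageFiveProofs
import HarnessLib

/-!
# BSD rank-≤1 residual cell — class X9: no published entry point survives (¬ram, ¬sst as theorems)

HONEST FRAMING (cell `b2b-bsdres-*`, verbatim): the goal of the cell is to DELETE the
COMBINATION-SHAPED residual classes for ALL analytic-rank ≤ 1 curves over ℚ — "full BSD formula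
for every rank ≤ 1 curve in class C" assembled STRICTLY from published theorems — so that the
rank-≤1 remainder becomes exactly the CONSTRUCTION-SHAPED classes, which are TYPED (missing-input
Props), NOT attempted; this is not "finishing BSD".

Theorems only (no definitions, no named facts), over the cell's predicates
(`Rank1Residual/Predicates.lean`: `Irr`, `Surj`, `Ram`, `Semistable`, `ClassX9`, `ClassX10`).
Sequel to `Rank1Residual/X9SmallImage.lean` (X9 prover gen 1: (im) is FALSE on X9, for every
`p`).  This file (X9 prover gen 2) makes the two OTHER conjuncts that every published `p`-part
theorem at an irreducible prime carries — a ramified multiplicative prime (ram), or semistability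
(sst) — into kernel theorems of the same shape, for every prime `p`:

* `surj_of_irr_of_ram` — **irr(p) ∧ ram(p) ⟹ surj(p)** (RESIDUAL-CASES (a-S) S1 F1): the inertia
  group at a multiplicative `ℓ ≠ p` with `p ∤ v_ℓ(Δ_min)` supplies a unipotent `σ ∈ Γ_ℚ` moving a
  `p`-torsion point (Tate curve; tree theorems
  `WeierstrassCurve.exists_inertia_smul_ne_of_hasMultiplicativeReductionAtPrime`,
  `WeierstrassCurve.exists_unipotent_of_hasMultiplicativeReductionAt`), so `ρ̄_{E,p}(σ)` has order
  `p` and `p ∣ #ρ̄(Γ_ℚ)`; but an irreducible proper image with full determinant has order prime to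
  `p` (Serre 1972 Prop. 15; tree `WeierstrassCurve.not_dvd_card_of_not_hasSurjectiveModNGaloisRep`).
  Hence `not_ram_of_irr_of_not_surj`, `ClassX9.not_ram`, `ClassX10.not_ram_of_not_surj`.
* `surj_of_irr_of_semistable` — **irr(p) ∧ sst ⟹ surj(p)** (Serre 1972 §5.4 Prop. 21 i);
  Edixhoven 1997 Prop. 2.1), the tree THEOREM
  `WeierstrassCurve.hasSurjectiveModNGaloisRep_of_hasIrreducibleModPGaloisRep_of_isSemistable`
  read through the cell's bridge `semistable_iff_isSemistable_ringOfIntegers`. Hence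
  `not_semistable_of_irr_of_not_surj`, `ClassX9.not_semistable` (X9 curves are NEVER semistable,
  in either rank — the predicate's clause "`r = 1 → ¬sst`" is automatic: `classX9_iff`),
  `ClassX10.not_semistable_of_not_surj`.

Consequence for the cell's route census of X9 (and of X10b = `ClassX10 ∧ ¬surj(3)`, referee
R6.1/R7.1): besides BCS 2025 Cor. 1.3.1 / Kato 2004 Thm. 17.4(3) / Yan–Zhu 2026 Thm. 4.15
((im)/(Im), dead by `ClassX9.not_bigIm`), EVERY other published class-level `p`-part input at an
irreducible prime has an unsatisfiable hypothesis on X9, now by kernel theorems rather than by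
remark: Skinner 2016 Thm. C and Skinner–Urban 2014 Thm. 2 ((ram): binder `_hram` of
`Skinner2016.thmC_padicValRat_bsd_rank_zero` — `ClassX9.not_ram`), Jetchev–Skinner–Wan 2017
Thm. 1.2.1 (`W.IsSemistable (𝓞 ℚ)` — `ClassX9.not_isSemistable`), Castella's erratum Thm. A′ and
Skinner–Zhang 2014 Thm. 1.2 (both imply ram(p): `Rank1Residual/X11.lean`,
`ram_of_erratumAprime_hypothesis`, `ram_of_skinnerZhang_hypotheses`).  What remains in print on
X9 is per-curve: Cha 2005 (J. Number Theory 111; Miller 2011 Thm. 5.2: `p ∤ 2Δ(K)`, `p² ∤ N`,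
`ρ̄_{E,p}` irreducible ⟹ `ord_p #Ш(E/ℚ) ≤ 2 ord_p I_K`) with Jetchev 2008 (Compositio 144;
Miller Thm. 5.4), an UPPER bound by the Heegner index `I_K`, which carries `#Ш_an` of the
quadratic twist `E^K` and is therefore not a class-level quantity (cell file
`b2b-bsdres-x9/X9-ROUTES-G2.md`).

## References

* [Serre1972] J.-P. Serre, Invent. Math. 15 (1972): §2.4 Prop. 15; §5.4 Prop. 21 i).
* [Edixhoven1997] B. Edixhoven, in Cornell–Silverman–Stevens (1997), Prop. 2.1 (PDF p. 285).
* [SilvermanATAEC1994] J. H. Silverman, GTM 151: V.4–V.5, Exercise 5.13(b) (Tate curve, inertia).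
* [Skinner2016PacificMC] C. Skinner, Pacific J. Math. 283 (2016), Thm. C (ii) and §2.5.
* [JetchevSkinnerWan2017] D. Jetchev, C. Skinner, X. Wan, Camb. J. Math. 5 (2017), Thm. 1.2.1.
* [Miller2011LMS] R. L. Miller, LMS J. Comput. Math. 14 (2011), Thms. 5.1–5.4.
-/

noncomputable section

open scoped Classical NumberField NNReal

open WeierstrassCurve Field NumberField IsDedekindDomain

namespace Literature.NumberTheory.EllipticCurves.Rank1Residual

variable (W : WeierstrassCurve ℚ) [W.IsElliptic] (p : ℕ) [Fact p.Prime]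

/-! ### (ram) ⟹ a transvection in the image ⟹ surjectivity under (irr) -/

/-- **irr(p) ∧ ram(p) ⟹ surj(p), for every prime `p`.**  If `E[p]` is irreducible and `E` has a
prime `ℓ ≠ p` of multiplicative reduction with `p ∤ v_ℓ(Δ_min)` (the cell's `Ram`, = hypothesis
(ram)/(mult) of Skinner–Urban 2014 Thm. 2, Skinner 2016 Thm. C (ii), in the Tate-curve
transcription of bsd.S30), then `ρ̄_{E,p}` is surjective: inertia at `ℓ` gives `σ ∈ Γ_ℚ` acting
on `E[p]` unipotently and non-trivially (Silverman ATAEC V, Ex. 5.13(b); tree theorems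
`exists_inertia_smul_ne_of_hasMultiplicativeReductionAtPrime`,
`exists_unipotent_of_hasMultiplicativeReductionAt`), so `ρ̄_{E,p}(σ)` has order `p`, whereas a
proper irreducible subgroup of `GL₂(𝔽_p)` with full determinant has order prime to `p` (Serre
1972 Prop. 15; `not_dvd_card_of_not_hasSurjectiveModNGaloisRep`).  This is RESIDUAL-CASES (a-S)
S1 F1 and the mechanism of Skinner 2016 §2.5 ("`ρ̄_f(τ) ≠ 1` … unipotent") as a kernel theorem.
[cite: Serre1972, §2.4 Prop. 15] [cite: SilvermanATAEC1994, V.4–V.5 and Exercise 5.13(b)] -/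
theorem surj_of_irr_of_ram [W.IsGloballyMinimal] (hirr : Irr W p) (hram : Ram W p) : Surj W p := by
  have hp : p.Prime := Fact.out
  by_contra hns
  -- `p ∤ #ρ̄_{E,p}(Γ_ℚ)`: irreducible + proper + `det` onto (Serre Prop. 15)
  obtain ⟨e, Φ, he, -⟩ := exists_frame_galoisRepTorsion_rat W p
  have hG : ¬ p ∣ Nat.card (galoisRepTorsion W p).range := by
    rw [← card_map_range_galoisRepTorsion W p Φ]
    exact not_dvd_card_of_not_hasSurjectiveModNGaloisRep W p Φ e he hirr hns
  -- the unipotent element of `Γ_ℚ` supplied by (ram)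
  obtain ⟨ℓ, hℓ, hℓp, hmult, hdiv⟩ := hram
  set v : HeightOneSpectrum (𝓞 ℚ) :=
    (Rat.HeightOneSpectrum.primesEquiv (R := 𝓞 ℚ)).symm ⟨ℓ, hℓ.out⟩ with hvdef
  have hv : Rat.HeightOneSpectrum.primesEquiv v = ⟨ℓ, hℓ.out⟩ := Equiv.apply_symm_apply _ _
  have hvℓ : (Rat.HeightOneSpectrum.primesEquiv v : ℕ) = ℓ := congrArg Subtype.val hv
  obtain ⟨w, hw⟩ := v.exists_spectralValuation
  obtain ⟨𝔐, h𝔐⟩ := v.localPrimesAbove_nonempty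
  have hmult_v : haveI := Fact.mk (Rat.HeightOneSpectrum.primesEquiv v).2;
      W.HasMultiplicativeReductionAtPrime (Rat.HeightOneSpectrum.primesEquiv v) := by
    have key : ∀ (q : ℕ) (hq : Fact q.Prime), q = ℓ →
        @WeierstrassCurve.HasMultiplicativeReductionAtPrime W q hq := by
      rintro q hq rfl; exact hmult
    exact key _ _ hvℓ
  have hram_v : ¬ p ∣ padicValNat (Rat.HeightOneSpectrum.primesEquiv v)
      W.minimalDiscriminantInt.natAbs := by
    rw [hvℓ]; exact hdiv
  have hℓp' : (Rat.HeightOneSpectrum.primesEquiv v : ℕ) ≠ p := by rw [hvℓ]; exact hℓp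
  have hloc := W.exists_inertia_smul_ne_of_hasMultiplicativeReductionAtPrime v hp hℓp' hmult_v
    hram_v hw h𝔐
  have hmultAt : W.HasMultiplicativeReductionAt v :=
    (WeierstrassCurve.hasMultiplicativeReductionAtPrime_iff_hasMultiplicativeReductionAt_ringOfIntegers
      W v).mp hmult_v
  have hpv : (p : 𝓞 ℚ) ∉ v.asIdeal := by
    intro hmem
    have hv' := (natCast_mem_asIdeal_iff_eq_primesEquiv_symm v hp).mp hmem
    apply hℓp'
    rw [hv', Equiv.apply_symm_apply]
  have hU := W.exists_unipotent_of_hasMultiplicativeReductionAt hmultAt hp hpv (le_refl 1) hw h𝔐 hloc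
  rw [pow_one] at hU
  obtain ⟨σ, hunip, Q, -, hσQ⟩ := hU
  -- `ρ̄_{E,p}(σ)` has order exactly `p`
  have hpow : galoisRepTorsion W p σ ^ p = 1 :=
    galoisRepTorsion_pow_prime_eq_one_of_unipotent W p hunip
  have hne : galoisRepTorsion W p σ ≠ 1 := fun h1 ↦
    hσQ ((galoisRepTorsion_eq_one_iff' W (p : ℤ) σ).mp h1 Q)
  have hord : orderOf (galoisRepTorsion W p σ) = p := by
    rcases (Nat.dvd_prime hp).mp (orderOf_dvd_of_pow_eq_one hpow) with h | h
    · exact absurd (orderOf_eq_one_iff.mp h) hne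
    · exact h
  have h2 : orderOf (galoisRepTorsion W p σ) ∣ Nat.card (galoisRepTorsion W p).range :=
    Subgroup.orderOf_dvd_natCard _ ⟨σ, rfl⟩
  rw [hord] at h2
  exact hG h2

/-- **irr(p) ∧ ¬surj(p) ⟹ ¬ram(p)** (contrapositive of `surj_of_irr_of_ram`): at a prime of
irreducible, non-surjective mod-`p` image, `E[p]` is unramified at EVERY multiplicative prime
`ℓ ≠ p` (`p ∣ v_ℓ(Δ_min)`), so the hypothesis (ram) of Skinner–Urban 2014 / Skinner 2016 Thm. C /
bsd.S30 `padicValRat_bsd_rank_zero` is unsatisfiable there. [cite: Serre1972, §2.4 Prop. 15] -/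
theorem not_ram_of_irr_of_not_surj [W.IsGloballyMinimal] (hirr : Irr W p) (hns : ¬ Surj W p) :
    ¬ Ram W p :=
  fun hram ↦ hns (surj_of_irr_of_ram W p hirr hram)

/-- **Class X9 ⟹ ¬ram(p)** — the census conjunct "⇒ ¬ram" of RESIDUAL-CASES §a.2 row X9 as a
kernel theorem: on X9 the binder `_hram` of `Skinner2016.thmC_padicValRat_bsd_rank_zero`
(Skinner 2016 Thm. C (ii)) and of bsd.S30 cannot be instantiated, so the referee's admissible
"sub-class X9 ∧ ram(p) ∧ r = 0 via Skinner Thm. C" (REFEREE.md R2) is EMPTY.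
[cite: Skinner2016PacificMC, Thm. C (ii) and §2.5] -/
theorem ClassX9.not_ram [W.IsGloballyMinimal] (h : ClassX9 W p) : ¬ Ram W p :=
  not_ram_of_irr_of_not_surj W p h.2.2.2.1 h.2.2.2.2.1

/-- **X10b ⟹ ¬ram(3)**: for `ClassX10` (`3` good ordinary, `E[3]` irreducible) with `ρ̄_{E,3}`
not surjective, there is no ramified multiplicative prime — so the referee's two descriptions of
the X9-shaped remainder of X10, "X10 ∧ ¬surj(3)" (R7.1) and "X10 ∧ ¬ram(3) ∧ ¬padic-surj(3)"
(R6.1), agree: ¬surj(3) already forces ¬ram(3) (and trivially ¬padic-surj(3)).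
[cite: Serre1972, §2.4 Prop. 15] -/
theorem ClassX10.not_ram_of_not_surj [W.IsGloballyMinimal] (h : ClassX10 W p) (hns : ¬ Surj W 3) :
    ¬ Ram W 3 :=
  not_ram_of_irr_of_not_surj W 3 h.2.2.1 hns

/-! ### (sst) ⟹ surjectivity under (irr) (Serre 1972 Prop. 21) -/

/-- **irr(p) ∧ sst ⟹ surj(p), for every prime `p`** (Serre 1972, §5.4 Prop. 21 i); Edixhoven
1997, Prop. 2.1 — PROVED in the tree:
`WeierstrassCurve.hasSurjectiveModNGaloisRep_of_hasIrreducibleModPGaloisRep_of_isSemistable`),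
over the cell's primewise predicate `Semistable` via the dedup bridge
`semistable_iff_isSemistable_ringOfIntegers`. [cite: Serre1972, §5.4 Prop. 21 i)] [cite: Edixhoven1997, Prop. 2.1 (PDF p. 285)] -/
theorem surj_of_irr_of_semistable [W.IsGloballyMinimal] (hirr : Irr W p) (hsst : Semistable W) :
    Surj W p :=
  W.hasSurjectiveModNGaloisRep_of_hasIrreducibleModPGaloisRep_of_isSemistable
    ((semistable_iff_isSemistable_ringOfIntegers W).mp hsst) p hirr

/-- **irr(p) ∧ ¬surj(p) ⟹ `E` is not semistable** (contrapositive of Serre's Prop. 21 i)): a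
curve with an irreducible, non-surjective mod-`p` image at some prime `p` has a prime of ADDITIVE
reduction. [cite: Serre1972, §5.4 Prop. 21 i)] -/
theorem not_semistable_of_irr_of_not_surj [W.IsGloballyMinimal] (hirr : Irr W p)
    (hns : ¬ Surj W p) : ¬ Semistable W :=
  fun hsst ↦ hns (surj_of_irr_of_semistable W p hirr hsst)

/-- **Class X9 ⟹ `E` is not semistable — in EITHER analytic rank.**  So the rank-1 clause
"(`r = 1 → ¬sst`)" of the census predicate is automatic (`classX9_iff`), every X9 curve has an
additive prime (census: `2268b1`, `N = 2²·3⁴·7`), and Jetchev–Skinner–Wan 2017 Thm. 1.2.1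
("Let `E` be a semistable elliptic curve") meets X9 in the empty set. [cite: Serre1972, §5.4 Prop. 21 i)] -/
theorem ClassX9.not_semistable [W.IsGloballyMinimal] (h : ClassX9 W p) : ¬ Semistable W :=
  not_semistable_of_irr_of_not_surj W p h.2.2.2.1 h.2.2.2.2.1

/-- **Class X9 ⟹ `¬ W.IsSemistable (𝓞 ℚ)`** — the spelling of the semistability binder of the
tree fact `JetchevSkinnerWan2017.thm121_padicValRat_bsd_rank_one` (JSW 2017 Thm. 1.2.1), which
therefore cannot be instantiated on X9. [cite: JetchevSkinnerWan2017, Thm. 1.2.1 (hypothesis: E semistable)] -/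
theorem ClassX9.not_isSemistable [W.IsGloballyMinimal] (h : ClassX9 W p) :
    ¬ W.IsSemistable (𝓞 ℚ) :=
  fun hsst ↦ ClassX9.not_semistable W p h ((semistable_iff_isSemistable_ringOfIntegers W).mpr hsst)

/-- **The X9 predicate without its rank clause.**  `ClassX9 W p` (¬cm ∧ ord(p) ∧ `p ≥ 5` ∧
irr(p) ∧ ¬surj(p) ∧ (`r = 1 → ¬sst`)) is equivalent to its first five conjuncts: the rank-1
clause "¬sst ∨ fails C3" of RESIDUAL-CASES §a.2 is a consequence of irr ∧ ¬surj
(`ClassX9.not_semistable`). [folklore] -/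
theorem classX9_iff [W.IsGloballyMinimal] :
    ClassX9 W p ↔ ¬ W.HasCM ∧ GoodOrd W p ∧ 5 ≤ p ∧ Irr W p ∧ ¬ Surj W p := by
  constructor
  · rintro ⟨hcm, hord, hp, hirr, hns, -⟩
    exact ⟨hcm, hord, hp, hirr, hns⟩
  · rintro ⟨hcm, hord, hp, hirr, hns⟩
    exact ⟨hcm, hord, hp, hirr, hns, fun _ ↦ not_semistable_of_irr_of_not_surj W p hirr hns⟩

/-- **X10b ⟹ `E` is not semistable**: `ClassX10` with `ρ̄_{E,3}` not surjective forces an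
additive prime (census X10b: `1210k1 = 2·5·11²`, `7442c1 = 2·61²`, `1690i1 = 2·5·13²`,
`6050x1 = 2·5²·11²`), so its rank-0 members lie outside Jetchev–Skinner–Wan / any semistable
theorem as well, exactly like X9. [cite: Serre1972, §5.4 Prop. 21 i)] -/
theorem ClassX10.not_semistable_of_not_surj [W.IsGloballyMinimal] (h : ClassX10 W p)
    (hns : ¬ Surj W 3) : ¬ Semistable W :=
  not_semistable_of_irr_of_not_surj W 3 h.2.2.1 hns


/-! ### Assembly: every published class-level hypothesis at an irreducible prime fails on X9 -/

/-- **X9 has no published entry point (assembly).**  On class X9 ALL of the following binders of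
the tree's vendored `p`-part facts are unsatisfiable at once: (im)/(Im) = `BigIm` (BCS 2025
Cor. 1.3.1 `cor131_padicValRat_bsd_rank_le_one`, Yan–Zhu 2026 `thm415_…_of_bigIm`, Kato 13.4(3));
(ram) = `Ram` (Skinner 2016 Thm. C `thmC_padicValRat_bsd_rank_zero`, Skinner–Urban 2014, bsd.S30);
(sst) = `Semistable` / `W.IsSemistable (𝓞 ℚ)` (Jetchev–Skinner–Wan 2017
`thm121_padicValRat_bsd_rank_one`); Skinner–Zhang 2014 Hypotheses (a)–(e)
(`SkinnerZhang2014.Hypotheses`, PRE) and the locus of Castella's erratum Thm. A′ (nonsplit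
multiplicative `q ≠ p` with `p ∤ v_q(Δ_min)`, PRE) — the last two via x11a's
`not_skinnerZhang_and_not_erratumAprime_of_not_ram`.  Wuthrich 2014 Prop. 21 excludes these
primes in its statement.  Hence no `bsd_p_of_X9_<type>` is assemblable from print; the class is
typed (`Typed/X9.lean`, Summits-side `Rank1ResidualX9Defs.lean`). [folklore] -/
theorem ClassX9.no_published_entry [W.IsGloballyMinimal] (h : ClassX9 W p) :
    ¬ BigIm W p ∧ ¬ Ram W p ∧ ¬ Semistable W ∧ ¬ W.IsSemistable (𝓞 ℚ) ∧
      ¬ SkinnerZhang2014.Hypotheses W p ∧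
      ¬ (∃ (q : ℕ) (_ : Fact q.Prime), q ≠ p ∧ W.HasMultiplicativeReductionAtPrime q ∧
          ¬ W.HasSplitMultiplicativeReductionAtPrime q ∧
          ¬ p ∣ padicValInt q W.minimalDiscriminantInt) :=
  ⟨ClassX9.not_bigIm W p h, ClassX9.not_ram W p h, ClassX9.not_semistable W p h,
    ClassX9.not_isSemistable W p h,
    (not_skinnerZhang_and_not_erratumAprime_of_not_ram (ClassX9.not_ram W p h)).1,
    (not_skinnerZhang_and_not_erratumAprime_of_not_ram (ClassX9.not_ram W p h)).2⟩

/-- **X10b has no published entry point (assembly)**: for `ClassX10 W p` (`p = 3`) with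
`¬ Surj W 3`, (Im), (ram) and (sst) all fail at `3`. [folklore] -/
theorem ClassX10.no_published_entry_of_not_surj [W.IsGloballyMinimal] (h : ClassX10 W p)
    (hns : ¬ Surj W 3) : ¬ BigIm W 3 ∧ ¬ Ram W 3 ∧ ¬ Semistable W :=
  ⟨ClassX10.not_bigIm_of_not_surj W p h hns, ClassX10.not_ram_of_not_surj W p h hns,
    ClassX10.not_semistable_of_not_surj W p h hns⟩

end Literature.NumberTheory.EllipticCurves.Rank1Residual
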